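import Summits.QuantumAdvantage.QuantumAdvantage.Theorems.CubicForrelationNearExactIsExactTwelveLevelFiveCPartnerAt2932
import Summits.QuantumAdvantage.QuantumAdvantage.Theorems.CubicForrelationNearExactIsExactTwelveLevelSixH34Small
import Summits.QuantumAdvantage.QuantumAdvantage.Theorems.CubicForrelationNearExactIsExactFlatRadical

/-!
# Crux `CubicForrelation.NearExactIsExact` (stmt-QuantumAdvantage-14043) — n = 12 AT `Φ = 29/32`: the mixed configuration
  "level-5(c) × level-6" is DEAD — so NO LEVEL-5 SIDE AT ALL at `29/32`

Certificate seat `b2b-cforr-cert` (gen 23).  HONEST FRAMING: kernel-checked finite-slice theorems (standard axioms; one `decide` inherited from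
`fr_radical_large`-style Boolean bookkeeping is NOT used here) about cubic Boolean pairs on 12 bits.  With `tw23_levelFive_partner_levelSix` and
`to23_typeO_ge2932_false`: a cubic pair with `29/32 ≤ Φ(f,g) < 1` has BOTH sides at Ax level `≥ 6` (`W_f, W_g ∈ 64ℤ`); whether `29/32` is a
value at `n = 12` is thereby reduced to the three level-6 × level-6 configurations of gen 22 (`tw22_levelSix_both_ge2932_reduction`).  It is NOT
decided here; NO new value of `θ₁₂`; NOT summit progress.  Paper: HOME/b2b-cforr-cert-g23/PROOF-N12-928-CC.md §5–§7.

THE ARGUMENT (`tw23_levelFive_levelSix_false`).  By `cp_partner_structure` the partner `f` (`W_f = 64u''`) has `Z = {u'' even} = z₀ ⊕ V₀`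
a 9-flat and `S̃ := e'' + Ω = ±1` on `Z`, `0` off `Z` (`e'' = u'' − (−1)^g`, `Ω ∈ {0,±4}` supported on a 16-set `C`), with
`ŝ = −128·S̃` for the transform `ŝ` of `e·1_P`.
1. (H3)/(H4) for `e''` on `Z` (`sm_H34_small`: off `Z ∪ C`, `e'' = 0`).  Since `4 ∣ Ω`, (H3) holds for `S̃ = sZ∘h` too, so the relative
   form `B` of `h` has base-free second differences (`fr_hsd`).
2. Walsh inversion: `Σ_y S̃(y)(−1)^{x·y} = −32·e(x)·1_P(x)`; Wiener–Khinchin (`cpk_wk`): the autocorrelation `Σ_y S̃(y)S̃(y⊕a)` equals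
   `¼·Σ_{x∈P} (−1)^{a·x} = 0` for `a ∉ {0, γ}` (`P` is the hyperplane `(−1)^{γ·x} = t_g`, `tw22_hyperplane_ge2932`).
3. A radical vector `a` of `B` is a period of `h` up to a constant (`fr_radical_period`), giving autocorrelation `±512`; so `rad B ⊆ {0,γ}`,
   `4·#rad B < 512`, and `fr_extract2` yields a frame `a₀,…,a₃ ∈ V₀` with Pfaffian `1`; by `ws_sum4_mod8` every 4-flat `x ⊕ ⟨a⟩` has
   `Σ sZ∘h ≡ 4 (mod 8)`.  Choosing `x ∈ Z` with the flat off `C` (`256 < 512`), (H4) gives `Σ sZ∘h = Σ e'' ≡ 0 (mod 8)` — contradiction.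

References: MacWilliams–Sloane (1977) Ch. 13–15; R. O'Donnell (2014) §1.4; Ax (1964) / McEliece (1972).  Axioms: the standard three.
-/

set_option linter.dupNamespace false -- D-0017: single-problem summit ⇒ `QuantumAdvantage.QuantumAdvantage` by design

noncomputable section

namespace Summit.QuantumAdvantage.QuantumAdvantage.Theorems.CubicForrelation.NearExactIsExact

open Finset
open Literature.Computability.QuantumComplexity
open Literature.Computability.QuantumComplexity.BuzetChailloux (bxor zeroVec bxor_bxor_cancel_left bxor_zeroVec zeroVec_bxor bxor_comm
  bxor_self)
open Literature.Computability.QuantumComplexity.DerivativeWalsh (W)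
open Literature.Computability.QuantumComplexity.BuzetChailloux (twist_bxor_right)
open Literature.Computability.QuantumComplexity.DerivativeWalsh (twist_bxor_left)
open Literature.Computability.QuantumComplexity.Simon (twist_eq_one_or)

/-! ### Wiener–Khinchin -/

/-- `y ⊕ y' ⊕ a = 0 ↔ y' = y ⊕ a`. [folklore] -/
theorem cpk_bxor_eq_zero_iff {n : ℕ} (y y' a : Fin n → Bool) :
    (bxor (bxor y y') a = fun _ => false) ↔ y' = bxor y a := by
  constructor
  · intro hz; funext j
    have hj := congrFun hz j
    simp only [bxor] at hj ⊢
    revert hj; cases y j <;> cases y' j <;> cases a j <;> decide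
  · rintro rfl; funext j; simp only [bxor]; cases y j <;> cases a j <;> rfl

/-- **Wiener–Khinchin over `𝔽₂ⁿ`**: `Σ_x (Σ_y F(y)(−1)^{y·x})²(−1)^{a·x} = 2ⁿ·Σ_y F(y)F(y⊕a)`. [cite: ODonnell2014, §1.4] -/
theorem cpk_wk {n : ℕ} (F : (Fin n → Bool) → ℝ) (a : Fin n → Bool) :
    ∑ x, (∑ y, F y * twist y x) ^ 2 * twist a x = (2 : ℝ) ^ n * ∑ y, F y * F (bxor y a) := by
  classical
  have step1 : ∀ x : Fin n → Bool, (∑ y, F y * twist y x) ^ 2 * twist a x =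
      ∑ y, ∑ y', F y * F y' * twist x (bxor (bxor y y') a) := by
    intro x
    rw [sq, sum_mul_sum, sum_mul]
    refine sum_congr rfl fun y _ => ?_
    rw [sum_mul]
    refine sum_congr rfl fun y' _ => ?_
    rw [twist_comm x, twist_bxor_left, twist_bxor_left, twist_comm a x]; ring
  calc ∑ x, (∑ y, F y * twist y x) ^ 2 * twist a x
      = ∑ x, ∑ y, ∑ y', F y * F y' * twist x (bxor (bxor y y') a) := sum_congr rfl fun x _ => step1 x
    _ = ∑ y, ∑ y', ∑ x, F y * F y' * twist x (bxor (bxor y y') a) := by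
        rw [sum_comm]; exact sum_congr rfl fun y _ => sum_comm
    _ = ∑ y, ∑ y', F y * F y' * (if (bxor (bxor y y') a = fun _ => false) then (2 : ℝ) ^ n else 0) := by
        refine sum_congr rfl fun y _ => sum_congr rfl fun y' _ => ?_
        rw [← mul_sum, tz_sum_twist_left]
    _ = ∑ y, F y * F (bxor y a) * (2 : ℝ) ^ n := by
        refine sum_congr rfl fun y _ => ?_
        rw [Finset.sum_eq_single (bxor y a)]
        · rw [if_pos ((cpk_bxor_eq_zero_iff y (bxor y a) a).2 rfl)]
        · intro y' _ hne
          rw [if_neg (fun h => hne ((cpk_bxor_eq_zero_iff y y' a).1 h)), mul_zero]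
        · intro h; exact absurd (mem_univ _) h
    _ = (2 : ℝ) ^ n * ∑ y, F y * F (bxor y a) := by rw [mul_sum]; exact sum_congr rfl fun y _ => by ring

/-! ### The kill -/

/-- **Level-5(c) × level-6 is DEAD** (12 bits): cubic `f, g` with `W_g = 32u'`, some `u'(x)` odd, `29/32 ≤ Φ(f,g) < 1` and `W_f = 64u''`
do not exist.  NOT summit progress. [this work] -/
theorem tw23_levelFive_levelSix_false (f g : (Fin (6 + 6) → Bool) → Bool) (hf : IsDegLeFun 3 f) (hg : IsDegLeFun 3 g)
    (u' : (Fin (6 + 6) → Bool) → ℤ) (hu' : ∀ x, W (fun y => signOf (g y)) x = (2 : ℝ) ^ 5 * (u' x : ℝ))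
    (hodd : ∃ x, Odd (u' x)) (hΦ : (29 / 32 : ℝ) ≤ forrelation f g) (hhi : forrelation f g < 1)
    (u'' : (Fin (6 + 6) → Bool) → ℤ) (hu'' : ∀ y, W (fun x => signOf (f x)) y = (2 : ℝ) ^ 6 * (u'' y : ℝ)) : False := by
  classical
  obtain ⟨-, -, ⟨V₀, z₀, hV0, hVadd, hVcard, hZS⟩, ⟨Ω, hΩval, hC, honZ, hoffZ, hshat⟩⟩ :=
    cp_partner_structure f g hf hg u' hu' hodd hΦ hhi u'' hu''
  set Z := (univ.filter fun y : Fin (6 + 6) → Bool => ¬ Odd (u'' y)) with hZdef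
  have hmemZ : ∀ y, y ∈ Z ↔ ¬ Odd (u'' y) := fun y => by simp [hZdef]
  have hVcard' : #V₀ = 512 := by rw [hVcard]; norm_num
  have hz₀ : z₀ ∈ Z := by rw [hZS]; exact mem_image.2 ⟨zeroVec, hV0, bxor_zeroVec _⟩
  have hPV : ∀ x, x ∈ Z → ∀ a ∈ V₀, bxor x a ∈ Z := fun x hx a ha => fl1_coset_vadd hVadd hZS hx ha
  have hVP : ∀ x, x ∈ Z → bxor z₀ x ∈ V₀ := fun x hx => fl1_coset_diff hZS hx
  -- the sign function `h` with `sZ ∘ h = S̃ = e'' + Ω` on `Z`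
  set h : (Fin (6 + 6) → Bool) → Bool := fun y => decide ((u'' y - sZ (g y) + Ω y) = -1) with hh
  have hpm : ∀ y ∈ Z, (u'' y - sZ (g y) + Ω y) = 1 ∨ (u'' y - sZ (g y) + Ω y) = -1 := by
    intro y hy
    have h1 := honZ y ((hmemZ y).1 hy)
    have h2 : ((u'' y - sZ (g y) + Ω y) - 1) * ((u'' y - sZ (g y) + Ω y) + 1) = 0 := by nlinarith
    rcases mul_eq_zero.1 h2 with h3 | h3
    · left; linarith
    · right; linarith
  have hsZ : ∀ y ∈ Z, sZ (h y) = (u'' y - sZ (g y) + Ω y) := by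
    intro y hy
    rcases hpm y hy with h1 | h1 <;> simp only [h, h1] <;> decide
  -- Step 1: (H3)/(H4) for `e''` on `Z`
  set Bd := (univ.filter fun y : Fin (6 + 6) → Bool => Ω y ≠ 0) with hBd
  have hoff8 : ∀ y, y ∉ Z → y ∉ Bd → (8 : ℤ) ∣ u'' y - sZ (g y) := by
    intro y hy hyB
    have hΩ0 : Ω y = 0 := by by_contra hne; exact hyB (mem_filter.2 ⟨mem_univ _, hne⟩)
    have ho : Odd (u'' y) := not_not.1 fun hn => hy ((hmemZ y).2 hn)
    have h0 := hoffZ y ho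
    rw [hΩ0, add_zero] at h0
    rw [h0]; exact dvd_zero 8
  obtain ⟨H3, H4⟩ := sm_H34_small g f hg hf u'' hu'' V₀ z₀ hV0 hVadd hVcard' hZS Bd hoff8 (by rw [hC]; norm_num)
  -- (H3) for `sZ ∘ h`
  have H3h : ∀ x, x ∈ Z → ∀ a b c : Fin (6 + 6) → Bool, a ∈ V₀ → b ∈ V₀ → c ∈ V₀ →
      (4 : ℤ) ∣ ∑ ε : Fin 3 → Bool, sZ (h (fun j => x j ^^ decide (Odd #(univ.filter fun i => ε i && (![a, b, c] : Fin 3 → Fin (6 + 6) → Bool) i j)))) := by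
    intro x hx a b c ha hb hc
    have hmem : ∀ ε : Fin 3 → Bool, (fun j => x j ^^ decide (Odd #(univ.filter fun i => ε i && (![a, b, c] : Fin 3 → Fin (6 + 6) → Bool) i j))) ∈ Z :=
      fun ε => fr_mem_flatPt3 V₀ hV0 (· ∈ Z) hPV hx _ (fun i => by fin_cases i <;> assumption) ε
    have e1 : ∑ ε : Fin 3 → Bool, sZ (h (fun j => x j ^^ decide (Odd #(univ.filter fun i => ε i && (![a, b, c] : Fin 3 → Fin (6 + 6) → Bool) i j)))) =
        ∑ ε : Fin 3 → Bool, (u'' (fun j => x j ^^ decide (Odd #(univ.filter fun i => ε i && (![a, b, c] : Fin 3 → Fin (6 + 6) → Bool) i j))) - sZ (g (fun j => x j ^^ decide (Odd #(univ.filter fun i => ε i && (![a, b, c] : Fin 3 → Fin (6 + 6) → Bool) i j))))) + ∑ ε : Fin 3 → Bool, Ω (fun j => x j ^^ decide (Odd #(univ.filter fun i => ε i && (![a, b, c] : Fin 3 → Fin (6 + 6) → Bool) i j))) := by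
      rw [← sum_add_distrib]; exact sum_congr rfl fun ε _ => by rw [hsZ _ (hmem ε)]
    have hΩ4 : (4 : ℤ) ∣ ∑ ε : Fin 3 → Bool, Ω (fun j => x j ^^ decide (Odd #(univ.filter fun i => ε i && (![a, b, c] : Fin 3 → Fin (6 + 6) → Bool) i j))) :=
      dvd_sum fun ε _ => by rcases hΩval (fun j => x j ^^ decide (Odd #(univ.filter fun i => ε i && (![a, b, c] : Fin 3 → Fin (6 + 6) → Bool) i j))) with h0 | h0 | h0 <;> rw [h0] <;> norm_num
    rw [e1]; exact dvd_add (H3 x hx a b c ha hb hc) hΩ4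
  have hsd := fr_hsd V₀ (· ∈ Z) z₀ hz₀ hVP h H3h
  -- Step 2: the autocorrelation of `S̃` vanishes off `{0, γ}`
  obtain ⟨γ, tg, htg, -, hP⟩ := tw22_hyperplane_ge2932 f g hg u' hu' hodd hΦ
  have h2 := tw23_levelFive_ge2932_shape f g hf hg u' hu' hodd hΦ
  obtain ⟨-, -, -, hone, -⟩ := l5t_layer2 f g hf hg u' hu' hodd hΦ h2
  have hT : ∀ x, ∑ y, (((u'' y - sZ (g y) + Ω y) : ℤ) : ℝ) * twist y x = -32 * (if Odd (u' x) then (((u' x - 2 * sZ (f x)) : ℤ) : ℝ) else 0) := by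
    intro x
    have hinv := tz_inversion (fun a => if Odd (u' a) then (((u' a - 2 * sZ (f a)) : ℤ) : ℝ) else 0) x
    have hW : ∀ y, W (fun a => if Odd (u' a) then (((u' a - 2 * sZ (f a)) : ℤ) : ℝ) else 0) y = -128 * (((u'' y - sZ (g y) + Ω y) : ℤ) : ℝ) := fun y => by
      unfold W; exact hshat y
    simp_rw [hW] at hinv
    have e2 : ∑ y, -128 * (((u'' y - sZ (g y) + Ω y) : ℤ) : ℝ) * twist y x = -128 * ∑ y, (((u'' y - sZ (g y) + Ω y) : ℤ) : ℝ) * twist y x := by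
      rw [mul_sum]; exact sum_congr rfl fun y _ => by ring
    rw [e2] at hinv
    have h4096 : (2 : ℝ) ^ (6 + 6) = 4096 := by norm_num
    rw [h4096] at hinv
    by_cases ho : Odd (u' x)
    · rw [if_pos ho] at hinv ⊢; linarith
    · rw [if_neg ho] at hinv ⊢; linarith
  have hauto : ∀ a : Fin (6 + 6) → Bool, a ≠ zeroVec → a ≠ γ → ∑ y, (((u'' y - sZ (g y) + Ω y) : ℤ) : ℝ) * (((u'' (bxor y a) - sZ (g (bxor y a)) + Ω (bxor y a)) : ℤ) : ℝ) = 0 := by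
    intro a ha0 haγ
    have hwk := cpk_wk (fun y => (((u'' y - sZ (g y) + Ω y) : ℤ) : ℝ)) a
    have hT2 : ∀ x, (∑ y, (((u'' y - sZ (g y) + Ω y) : ℤ) : ℝ) * twist y x) ^ 2 * twist a x = 1024 * ((if Odd (u' x) then (1 : ℝ) else 0) * twist a x) := by
      intro x
      rw [hT x]
      by_cases ho : Odd (u' x)
      · rw [if_pos ho, if_pos ho]
        have h1 : (((u' x - 2 * sZ (f x)) : ℤ) : ℝ) ^ 2 = 1 := by exact_mod_cast hone x ho
        rw [show (-32 * (((u' x - 2 * sZ (f x)) : ℤ) : ℝ)) ^ 2 = 1024 * (((u' x - 2 * sZ (f x)) : ℤ) : ℝ) ^ 2 by ring, h1]; ring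
      · rw [if_neg ho, if_neg ho]; ring
    have hind : ∀ x, (if Odd (u' x) then (1 : ℝ) else 0) * twist a x = (twist x a + tg * twist x (bxor γ a)) / 2 := by
      intro x
      rw [twist_bxor_right, twist_comm x a, twist_comm x γ]
      by_cases ho : Odd (u' x)
      · rw [if_pos ho, (hP x).1 ho]
        rcases htg with ht | ht <;> rw [ht] <;> ring
      · rw [if_neg ho]
        have hne : twist γ x ≠ tg := fun h' => ho ((hP x).2 h')
        rcases htg with ht | ht <;> rcases twist_eq_one_or γ x with h' | h'
        · exact absurd h' (ht ▸ hne)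
        · rw [ht, h']; ring
        · rw [ht, h']; ring
        · exact absurd h' (ht ▸ hne)
    have hzero : zeroVec = (fun _ : Fin (6 + 6) => false) := rfl
    have hsum : ∑ x, (∑ y, (((u'' y - sZ (g y) + Ω y) : ℤ) : ℝ) * twist y x) ^ 2 * twist a x = 0 := by
      rw [sum_congr rfl fun x _ => hT2 x, ← mul_sum, sum_congr rfl fun x _ => hind x, ← sum_div, sum_add_distrib,
        ← mul_sum, tz_sum_twist_left, tz_sum_twist_left, if_neg, if_neg]
      · ring
      · intro h'; apply haγ
        have h'' := congrArg (bxor γ) h'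
        rw [bxor_bxor_cancel_left] at h''
        rw [h'']; funext j; simp [bxor]
      · rw [← hzero]; exact ha0
    rw [hwk] at hsum
    have h4096 : (2 : ℝ) ^ (6 + 6) ≠ 0 := by positivity
    exact (mul_eq_zero.1 hsum).resolve_left h4096
  -- Step 3: the radical is inside `{0, γ}`
  set R := V₀.filter (fun a => ∀ b ∈ V₀, (h z₀ ^^ h (bxor z₀ a) ^^ h (bxor z₀ b) ^^ h (bxor (bxor z₀ a) b)) = false) with hR
  have hRsub : R ⊆ {zeroVec, γ} := by
    intro a haR
    by_contra hne
    rw [mem_insert, mem_singleton, not_or] at hne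
    have hper : ∀ y ∈ Z, h (bxor y a) = (h y ^^ (h z₀ ^^ h (bxor z₀ a))) :=
      fun y hy => fr_radical_period V₀ (· ∈ Z) z₀ h hz₀ hVP hsd haR hy
    have haV : a ∈ V₀ := (mem_filter.1 haR).1
    have hprod : ∀ y, (((u'' y - sZ (g y) + Ω y) : ℤ) : ℝ) * (((u'' (bxor y a) - sZ (g (bxor y a)) + Ω (bxor y a)) : ℤ) : ℝ) = sZ (h z₀ ^^ h (bxor z₀ a)) * (((u'' y - sZ (g y) + Ω y) : ℤ) : ℝ) ^ 2 := by
      intro y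
      by_cases hy : y ∈ Z
      · have hya : bxor y a ∈ Z := hPV y hy a haV
        have e1 : (u'' (bxor y a) - sZ (g (bxor y a)) + Ω (bxor y a)) = sZ (h z₀ ^^ h (bxor z₀ a)) * (u'' y - sZ (g y) + Ω y) := by
          rw [← hsZ _ hya, ← hsZ _ hy, hper y hy, Bool.xor_comm (h y), tee_sZ_xor]
        have e1R : (((u'' (bxor y a) - sZ (g (bxor y a)) + Ω (bxor y a)) : ℤ) : ℝ) = ((sZ (h z₀ ^^ h (bxor z₀ a)) : ℤ) : ℝ) * (((u'' y - sZ (g y) + Ω y) : ℤ) : ℝ) := by exact_mod_cast e1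
        rw [e1R]; ring
      · have ho : Odd (u'' y) := not_not.1 fun hn => hy ((hmemZ y).2 hn)
        have h0 : (((u'' y - sZ (g y) + Ω y) : ℤ) : ℝ) = 0 := by exact_mod_cast hoffZ y ho
        rw [h0]; ring
    have hsq : ∑ y, (((u'' y - sZ (g y) + Ω y) : ℤ) : ℝ) ^ 2 = 512 := by
      rw [← sum_filter_add_sum_filter_not univ (fun y : Fin (6 + 6) → Bool => ¬ Odd (u'' y))]
      have h1 : ∑ y ∈ univ.filter (fun y : Fin (6 + 6) → Bool => ¬ Odd (u'' y)), (((u'' y - sZ (g y) + Ω y) : ℤ) : ℝ) ^ 2 = 512 := by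
        have : ∀ y ∈ univ.filter (fun y : Fin (6 + 6) → Bool => ¬ Odd (u'' y)), (((u'' y - sZ (g y) + Ω y) : ℤ) : ℝ) ^ 2 = 1 := fun y hy => by
          exact_mod_cast honZ y ((hmemZ y).1 hy)
        rw [sum_congr rfl this, sum_const, nsmul_eq_mul, mul_one]
        have hZc : #Z = 512 := by
          rw [hZS, card_image_of_injective _ (fun y y' hyy => by
            have h' := congrArg (bxor z₀) hyy
            rwa [bxor_bxor_cancel_left, bxor_bxor_cancel_left] at h'), hVcard']
        exact_mod_cast hZc
      have h2 : ∑ y ∈ univ.filter (fun y : Fin (6 + 6) → Bool => ¬ ¬ Odd (u'' y)), (((u'' y - sZ (g y) + Ω y) : ℤ) : ℝ) ^ 2 = 0 :=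
        sum_eq_zero fun y hy => by
          have ho : Odd (u'' y) := not_not.1 (mem_filter.1 hy).2
          have h0 : (((u'' y - sZ (g y) + Ω y) : ℤ) : ℝ) = 0 := by exact_mod_cast hoffZ y ho
          rw [h0]; ring
      rw [h1, h2, add_zero]
    have hA := hauto a hne.1 hne.2
    rw [sum_congr rfl fun y _ => hprod y, ← mul_sum, hsq] at hA
    have hσ : ((sZ (h z₀ ^^ h (bxor z₀ a)) : ℤ) : ℝ) = 1 ∨ ((sZ (h z₀ ^^ h (bxor z₀ a)) : ℤ) : ℝ) = -1 := by
      rcases tp_sZ_cases (h z₀ ^^ h (bxor z₀ a)) with h1 | h1 <;> rw [h1] <;> norm_num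
    rcases hσ with h1 | h1 <;> rw [h1] at hA <;> norm_num at hA
  have hRcard : #R ≤ 2 := (card_le_card hRsub).trans (card_insert_le _ _ |>.trans (by rw [card_singleton]))
  -- Step 4: a frame with Pfaffian `1` and a 4-flat off `C`
  have hlt : 4 * #R < #V₀ := by rw [hVcard']; omega
  obtain ⟨a₀, ha₀, a₁, ha₁, a₂, ha₂, a₃, ha₃, h01, h23, h02, h03, h12, h13⟩ :=
    fr_extract2 V₀ (· ∈ Z) z₀ h hz₀ hPV hVadd hsd hlt
  have ha : ∀ i, (![a₀, a₁, a₂, a₃] : Fin 4 → Fin (6 + 6) → Bool) i ∈ V₀ := by intro i; fin_cases i <;> assumption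
  have hcε : ∀ ε : Fin 4 → Bool, (fun j => zeroVec j ^^ decide (Odd #(univ.filter fun i => ε i && (![a₀, a₁, a₂, a₃] : Fin 4 → Fin (6 + 6) → Bool) i j))) ∈ V₀ :=
    fun ε => ws_flatPt_mem V₀ hV0 (fun z => z ∈ V₀) (fun z hz b hb => hVadd z hz b hb) 4 zeroVec hV0 _ ha ε
  set BadX := (univ : Finset (Fin 4 → Bool)).biUnion (fun ε => Bd.image (fun b => bxor b (fun j => zeroVec j ^^ decide (Odd #(univ.filter fun i => ε i && (![a₀, a₁, a₂, a₃] : Fin 4 → Fin (6 + 6) → Bool) i j))))) with hBadX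
  have hBadXcard : #BadX < #Z := by
    have hZc : #Z = 512 := by
      rw [hZS, card_image_of_injective _ (fun y y' hyy => by
        have h' := congrArg (bxor z₀) hyy
        rwa [bxor_bxor_cancel_left, bxor_bxor_cancel_left] at h'), hVcard']
    calc #BadX ≤ ∑ ε : Fin 4 → Bool, #(Bd.image (fun b => bxor b (fun j => zeroVec j ^^ decide (Odd #(univ.filter fun i => ε i && (![a₀, a₁, a₂, a₃] : Fin 4 → Fin (6 + 6) → Bool) i j))))) := card_biUnion_le
      _ ≤ ∑ ε : Fin 4 → Bool, #Bd := sum_le_sum fun ε _ => card_image_le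
      _ = 2 ^ 4 * #Bd := by rw [sum_const, card_univ, Fintype.card_fun, Fintype.card_bool, Fintype.card_fin, smul_eq_mul]
      _ < #Z := by rw [hC, hZc]; norm_num
  obtain ⟨x, hx, hxB⟩ := exists_mem_notMem_of_card_lt_card hBadXcard
  have hmem4 : ∀ ε : Fin 4 → Bool, (fun j => x j ^^ decide (Odd #(univ.filter fun i => ε i && (![a₀, a₁, a₂, a₃] : Fin 4 → Fin (6 + 6) → Bool) i j))) ∈ Z :=
    fun ε => fr_mem_flatPt4 V₀ hV0 (· ∈ Z) hPV hx _ ha ε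
  have hΩ0 : ∀ ε : Fin 4 → Bool, Ω (fun j => x j ^^ decide (Odd #(univ.filter fun i => ε i && (![a₀, a₁, a₂, a₃] : Fin 4 → Fin (6 + 6) → Bool) i j))) = 0 := by
    intro ε
    by_contra hne
    refine hxB (mem_biUnion.2 ⟨ε, mem_univ _, mem_image.2 ⟨(fun j => x j ^^ decide (Odd #(univ.filter fun i => ε i && (![a₀, a₁, a₂, a₃] : Fin 4 → Fin (6 + 6) → Bool) i j))), mem_filter.2 ⟨mem_univ _, hne⟩, ?_⟩⟩)
    rw [ws_flatPt_eq_bxor x _ ε, iw_bxor_assoc, bxor_self, bxor_zeroVec]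
  -- (H4) there: `Σ sZ∘h = Σ e'' ≡ 0 (mod 8)`
  have h8 : (8 : ℤ) ∣ ∑ ε : Fin 4 → Bool, sZ (h (fun j => x j ^^ decide (Odd #(univ.filter fun i => ε i && (![a₀, a₁, a₂, a₃] : Fin 4 → Fin (6 + 6) → Bool) i j)))) := by
    have e1 : ∑ ε : Fin 4 → Bool, sZ (h (fun j => x j ^^ decide (Odd #(univ.filter fun i => ε i && (![a₀, a₁, a₂, a₃] : Fin 4 → Fin (6 + 6) → Bool) i j)))) = ∑ ε : Fin 4 → Bool, (u'' (fun j => x j ^^ decide (Odd #(univ.filter fun i => ε i && (![a₀, a₁, a₂, a₃] : Fin 4 → Fin (6 + 6) → Bool) i j))) - sZ (g (fun j => x j ^^ decide (Odd #(univ.filter fun i => ε i && (![a₀, a₁, a₂, a₃] : Fin 4 → Fin (6 + 6) → Bool) i j))))) :=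
      sum_congr rfl fun ε _ => by rw [hsZ _ (hmem4 ε), hΩ0 ε, add_zero]
    rw [e1]; exact H4 x hx a₀ a₁ a₂ a₃ ha₀ ha₁ ha₂ ha₃
  -- but the Pfaffian of the frame is `1`: `Σ sZ∘h ≡ 4 (mod 8)`
  have hws := ws_sum4_mod8 V₀ (· ∈ Z) z₀ h hPV hsd (x := x) hx ha₀ ha₁ ha₂ ha₃
  have hsymm := fr_B_symm z₀ h
  rw [hsymm a₁ a₀, hsymm a₃ a₂, hsymm a₂ a₀, hsymm a₃ a₁, hsymm a₃ a₀, hsymm a₂ a₁, h01, h23, h02, h13, h03, h12] at hws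
  simp only [Bool.true_and, Bool.false_and, Bool.xor_false, if_true] at hws
  omega

/-- **NO LEVEL-5 SIDE at `29/32 ≤ Φ < 1` (12 bits)**: cubic `f, g` with `W_g = 32u'`, some `u'(x)` odd and `29/32 ≤ Φ(f,g) < 1` do not
exist (the partner is at level `≥ 6` by `tw23_levelFive_partner_levelSix`, and that is `tw23_levelFive_levelSix_false`).  Hence at the
boundary rung both sides have `W ∈ 64ℤ`.  NOT summit progress. [this work] -/
theorem tw23_levelFive_ge2932_false (f g : (Fin (6 + 6) → Bool) → Bool) (hf : IsDegLeFun 3 f) (hg : IsDegLeFun 3 g)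
    (u' : (Fin (6 + 6) → Bool) → ℤ) (hu' : ∀ x, W (fun y => signOf (g y)) x = (2 : ℝ) ^ 5 * (u' x : ℝ))
    (hodd : ∃ x, Odd (u' x)) (hΦ : (29 / 32 : ℝ) ≤ forrelation f g) (hhi : forrelation f g < 1) : False := by
  obtain ⟨u'', hu''⟩ := tw23_levelFive_partner_levelSix f g hf hg u' hu' hodd hΦ
  exact tw23_levelFive_levelSix_false f g hf hg u' hu' hodd hΦ hhi u'' hu''

/-- **Both sides at level `≥ 6` at the boundary rung** (12 bits): for cubic `f, g` with `29/32 ≤ Φ(f,g) < 1`, `W_g ∈ 64ℤ` and `W_f ∈ 64ℤ`.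
NOT summit progress. [this work] -/
theorem tw23_ge2932_levelSix (f g : (Fin (6 + 6) → Bool) → Bool) (hf : IsDegLeFun 3 f) (hg : IsDegLeFun 3 g)
    (hΦ : (29 / 32 : ℝ) ≤ forrelation f g) (hhi : forrelation f g < 1) :
    (∃ u'' : (Fin (6 + 6) → Bool) → ℤ, ∀ x, W (fun y => signOf (g y)) x = (2 : ℝ) ^ 6 * (u'' x : ℝ)) ∧
      (∃ wf : (Fin (6 + 6) → Bool) → ℤ, ∀ y, W (fun x => signOf (f x)) y = (2 : ℝ) ^ 6 * (wf y : ℝ)) := by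
  obtain ⟨⟨u', hu'⟩, ⟨uf, huf⟩⟩ := tw23_ge2932_levelFive f g hf hg hΦ
  have hΦ' : forrelation g f = forrelation f g := by
    rw [Summit.QuantumAdvantage.QuantumAdvantage.Theorems.SignedCubicForrelationNotPrBPP.Negative.HalfQuad.forrelation_comm]
  constructor
  · have hO : ∀ x, ¬ Odd (u' x) := fun x hx => tw23_levelFive_ge2932_false f g hf hg u' hu' ⟨x, hx⟩ hΦ hhi
    exact ⟨fun x => u' x / 2, tw_level_up (j := 5) g u' hu' hO⟩
  · have hO : ∀ y, ¬ Odd (uf y) := fun y hy =>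
      tw23_levelFive_ge2932_false g f hg hf uf huf ⟨y, hy⟩ (by rw [hΦ']; exact hΦ) (by rw [hΦ']; exact hhi)
    exact ⟨fun y => uf y / 2, tw_level_up (j := 5) f uf huf hO⟩

end Summit.QuantumAdvantage.QuantumAdvantage.Theorems.CubicForrelation.NearExactIsExact

end
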